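import Summits.Ventures.Crystal3D.Theorems.StickyWulffConstantStackingLiminfPlateauProfile
import Literature.InformationTheory.Coding.SourcePolarizationStepMinus
import HarnessLib

/-!
# Lateral majorant / minorant of the mollifier in one layer (step S4(i) of stub (B), line `LayerChain`
# v4, crux `StackingLiminf`, stmt-Ventures-19145) — pointwise tools for the per-layer quadrature

Route `StickyWulffConstant` of the venture `Summits/Ventures/Crystal3D` (cell `crystal3d-full`).
For a layer with lateral points `P(i,j) = (i + j/2 + c₁, (√3/2) j + c₂)` seen from a point `y` at height
offset `ζ` (summand `bump K (y₁ − P₁, y₂ − P₂, ζ)`):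
* lateral Euclidean length `√(a²+b²)`: 1-Lipschitz in the radius (the planar triangle inequality
  `sqrt_sq_add_sq_add_le` is imported from `Literature.InformationTheory.Coding.Polar`);
* `bump_vec_eq_profile` — `φ_K(d₁,d₂,ζ) = c_K G(√(r²+ζ²)/K)`, `r` the lateral radius;
* `bump_le_lateral_majorant` / `lateral_minorant_le_bump` — on a cell (lateral distance `≤ 2` from the
  centre `p`): `c_K G(√((r_q+2)²+ζ²)/K) ≤ φ_K(y − p, ζ) ≤ c_K G(√((r_q−2)₊²+ζ²)/K)`, `r_q = |q − y|`;
* `lateral_majorant_sub_bump_le` / `bump_sub_lateral_minorant_le` — at the same point the majorant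
  (resp. bump) exceeds the bump (resp. minorant) by `≤ (12 c_K/K)·1_{B̄_∞(y, K+2)}` (resp. `1_{B̄_∞(y,K)}`).
The per-layer sums (`layerSum_le/ge`) are in `…LayerSum`.
WHAT THIS IS NOT: not stub (B); rung F-C1 not moved.
-/

noncomputable section

namespace Summit.Ventures.Crystal3D.Theorems.PlateauHeight

open MeasureTheory Set Metric
open Summit.Ventures.Crystal3D.Cruxes.StackingLiminf.LayerChainV4 (bump bumpConst layerProf)
open Summit.Ventures.Crystal3D.LayerChain (dot3)
open Literature.InformationTheory.Coding.Polar (sqrt_sq_add_sq_add_le)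

/-! ### Lateral Euclidean length -/

/-- `√` is 1-Lipschitz in the lateral radius: `√(a² + ζ²) − √(b² + ζ²) ≤ |a − b|`. -/
theorem sqrt_sq_add_sub_le (a b ζ : ℝ) :
    Real.sqrt (a ^ 2 + ζ ^ 2) - Real.sqrt (b ^ 2 + ζ ^ 2) ≤ |a - b| := by
  have h := sqrt_sq_add_sq_add_le b ζ (a - b) 0
  simp only [add_zero] at h
  rw [show b + (a - b) = a by ring] at h
  have e : Real.sqrt ((a - b) ^ 2 + 0 ^ 2) = |a - b| := by
    rw [zero_pow two_ne_zero, add_zero, Real.sqrt_sq_eq_abs]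
  linarith [e]

/-- The bump at `(d₁, d₂, ζ)` as a profile of the lateral radius. -/
theorem bump_vec_eq_profile {K : ℝ} (hK : 0 < K) (d₁ d₂ ζ : ℝ) :
    bump K (![d₁, d₂, ζ] : Fin 3 → ℝ) = bumpConst / K ^ 3 *
      (max 0 (1 - (max 0 (Real.sqrt (Real.sqrt (d₁ ^ 2 + d₂ ^ 2) ^ 2 + ζ ^ 2) / K)) ^ 2)) ^ 3 := by
  rw [bump_eq_profile hK]
  have e : dot3 (![d₁, d₂, ζ] : Fin 3 → ℝ) ![d₁, d₂, ζ] = Real.sqrt (d₁ ^ 2 + d₂ ^ 2) ^ 2 + ζ ^ 2 := by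
    rw [Real.sq_sqrt (by positivity)]
    simp [dot3]; ring
  rw [e]

/-! ### Majorant and minorant on a cell -/

/-- **Lateral majorant.**  If `q` is within lateral distance `2` of `p`:
`φ_K(y − p, ζ) ≤ c_K G(√((r_q − 2)₊² + ζ²)/K)`, `r_q = |q − y|`. -/
theorem bump_le_lateral_majorant {K : ℝ} (hK : 0 < K) (ζ : ℝ) (y p q : ℝ × ℝ)
    (hq : Real.sqrt ((q.1 - p.1) ^ 2 + (q.2 - p.2) ^ 2) ≤ 2) :
    bump K (![y.1 - p.1, y.2 - p.2, ζ] : Fin 3 → ℝ) ≤ bumpConst / K ^ 3 *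
      (max 0 (1 - (max 0 (Real.sqrt ((max 0 (Real.sqrt ((q.1 - y.1) ^ 2 + (q.2 - y.2) ^ 2) - 2)) ^ 2
        + ζ ^ 2) / K)) ^ 2)) ^ 3 := by
  rw [bump_vec_eq_profile hK]
  refine mul_le_mul_of_nonneg_left (profile_antitone ?_)
    (div_nonneg bumpConst_pos.le (pow_nonneg hK.le 3))
  apply div_le_div_of_nonneg_right _ hK.le
  apply Real.sqrt_le_sqrt
  have hrp : 0 ≤ Real.sqrt ((y.1 - p.1) ^ 2 + (y.2 - p.2) ^ 2) := Real.sqrt_nonneg _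
  -- `r_q ≤ r_p + |q − p|`, so `(r_q − 2)₊ ≤ r_p`
  have htri := sqrt_sq_add_sq_add_le (p.1 - y.1) (p.2 - y.2) (q.1 - p.1) (q.2 - p.2)
  rw [show p.1 - y.1 + (q.1 - p.1) = q.1 - y.1 by ring,
    show p.2 - y.2 + (q.2 - p.2) = q.2 - y.2 by ring] at htri
  have e : Real.sqrt ((p.1 - y.1) ^ 2 + (p.2 - y.2) ^ 2) = Real.sqrt ((y.1 - p.1) ^ 2 + (y.2 - p.2) ^ 2) := by
    congr 1; ring
  rw [e] at htri
  have hm : max 0 (Real.sqrt ((q.1 - y.1) ^ 2 + (q.2 - y.2) ^ 2) - 2) ≤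
      Real.sqrt ((y.1 - p.1) ^ 2 + (y.2 - p.2) ^ 2) := max_le hrp (by linarith)
  nlinarith [le_max_left 0 (Real.sqrt ((q.1 - y.1) ^ 2 + (q.2 - y.2) ^ 2) - 2)]

/-- **Lateral minorant.**  If `q` is within lateral distance `2` of `p`:
`c_K G(√((r_q + 2)² + ζ²)/K) ≤ φ_K(y − p, ζ)`. -/
theorem lateral_minorant_le_bump {K : ℝ} (hK : 0 < K) (ζ : ℝ) (y p q : ℝ × ℝ)
    (hq : Real.sqrt ((q.1 - p.1) ^ 2 + (q.2 - p.2) ^ 2) ≤ 2) :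
    bumpConst / K ^ 3 *
      (max 0 (1 - (max 0 (Real.sqrt ((Real.sqrt ((q.1 - y.1) ^ 2 + (q.2 - y.2) ^ 2) + 2) ^ 2
        + ζ ^ 2) / K)) ^ 2)) ^ 3 ≤ bump K (![y.1 - p.1, y.2 - p.2, ζ] : Fin 3 → ℝ) := by
  rw [bump_vec_eq_profile hK]
  refine mul_le_mul_of_nonneg_left (profile_antitone ?_)
    (div_nonneg bumpConst_pos.le (pow_nonneg hK.le 3))
  apply div_le_div_of_nonneg_right _ hK.le
  apply Real.sqrt_le_sqrt
  have hrp : 0 ≤ Real.sqrt ((y.1 - p.1) ^ 2 + (y.2 - p.2) ^ 2) := Real.sqrt_nonneg _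
  have hrq : 0 ≤ Real.sqrt ((q.1 - y.1) ^ 2 + (q.2 - y.2) ^ 2) := Real.sqrt_nonneg _
  -- `r_p ≤ r_q + |p − q|`
  have htri := sqrt_sq_add_sq_add_le (q.1 - y.1) (q.2 - y.2) (p.1 - q.1) (p.2 - q.2)
  rw [show q.1 - y.1 + (p.1 - q.1) = -(y.1 - p.1) by ring,
    show q.2 - y.2 + (p.2 - q.2) = -(y.2 - p.2) by ring, neg_sq, neg_sq] at htri
  have e : Real.sqrt ((p.1 - q.1) ^ 2 + (p.2 - q.2) ^ 2) = Real.sqrt ((q.1 - p.1) ^ 2 + (q.2 - p.2) ^ 2) := by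
    congr 1; ring
  rw [e] at htri
  nlinarith

/-- **Majorant vs bump at the same point**:
`c_K G(√((r − 2)₊² + ζ²)/K) − φ_K(q − y, ζ) ≤ (12 c_K/K) · 1_{B̄_∞(y, K+2)}(q)`. -/
theorem lateral_majorant_sub_bump_le {K : ℝ} (hK : 0 < K) (ζ : ℝ) (y q : ℝ × ℝ) :
    bumpConst / K ^ 3 *
      (max 0 (1 - (max 0 (Real.sqrt ((max 0 (Real.sqrt ((q.1 - y.1) ^ 2 + (q.2 - y.2) ^ 2) - 2)) ^ 2
        + ζ ^ 2) / K)) ^ 2)) ^ 3 - bump K (![q.1 - y.1, q.2 - y.2, ζ] : Fin 3 → ℝ) ≤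
      (closedBall y (K + 2)).indicator (fun _ => 12 * bumpConst / K ^ 4) q := by
  have hc : 0 ≤ bumpConst / K ^ 3 := div_nonneg bumpConst_pos.le (pow_nonneg hK.le 3)
  set r : ℝ := Real.sqrt ((q.1 - y.1) ^ 2 + (q.2 - y.2) ^ 2) with hr
  have hr0 : 0 ≤ r := Real.sqrt_nonneg _
  rw [bump_vec_eq_profile hK]
  rw [← hr]
  by_cases hq : q ∈ closedBall y (K + 2)
  · rw [indicator_of_mem hq, ← mul_sub]
    have hρ : Real.sqrt ((max 0 (r - 2)) ^ 2 + ζ ^ 2) / K ≤ Real.sqrt (r ^ 2 + ζ ^ 2) / K := by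
      apply div_le_div_of_nonneg_right _ hK.le
      apply Real.sqrt_le_sqrt
      have : max 0 (r - 2) ≤ r := max_le hr0 (by linarith)
      nlinarith [le_max_left 0 (r - 2)]
    have h := profile_sub_le hρ
    have hd : Real.sqrt (r ^ 2 + ζ ^ 2) / K - Real.sqrt ((max 0 (r - 2)) ^ 2 + ζ ^ 2) / K ≤ 2 / K := by
      rw [← sub_div]
      apply div_le_div_of_nonneg_right _ hK.le
      have := sqrt_sq_add_sub_le r (max 0 (r - 2)) ζ
      have hmr : max 0 (r - 2) ≤ r := max_le hr0 (by linarith)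
      have hm : |r - max 0 (r - 2)| ≤ 2 := by
        rw [abs_le]; constructor
        · linarith [le_max_left 0 (r - 2)]
        · rcases le_total 0 (r - 2) with h2 | h2
          · rw [max_eq_right h2]; linarith
          · rw [max_eq_left h2]; linarith
      linarith
    calc bumpConst / K ^ 3 * ((max 0 (1 - max 0 (Real.sqrt ((max 0 (r - 2)) ^ 2 + ζ ^ 2) / K) ^ 2)) ^ 3 -
          (max 0 (1 - max 0 (Real.sqrt (r ^ 2 + ζ ^ 2) / K) ^ 2)) ^ 3)
        ≤ bumpConst / K ^ 3 * (6 * (2 / K)) :=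
          mul_le_mul_of_nonneg_left (h.trans (by linarith)) hc
      _ = 12 * bumpConst / K ^ 4 := by field_simp; ring
  · rw [indicator_of_notMem hq]
    have hq' : K + 2 < ‖q - y‖ := by rwa [mem_closedBall, dist_eq_norm, not_le] at hq
    have hrK : K + 2 < r := by
      rw [Prod.norm_def] at hq'
      rcases lt_max_iff.1 hq' with h | h
      · rw [Real.norm_eq_abs] at h
        calc K + 2 < |q.1 - y.1| := h
          _ = Real.sqrt ((q.1 - y.1) ^ 2) := (Real.sqrt_sq_eq_abs _).symm
          _ ≤ r := Real.sqrt_le_sqrt (by nlinarith)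
      · rw [Real.norm_eq_abs] at h
        calc K + 2 < |q.2 - y.2| := h
          _ = Real.sqrt ((q.2 - y.2) ^ 2) := (Real.sqrt_sq_eq_abs _).symm
          _ ≤ r := Real.sqrt_le_sqrt (by nlinarith)
    have h1 : 1 < Real.sqrt ((max 0 (r - 2)) ^ 2 + ζ ^ 2) / K := by
      rw [lt_div_iff₀ hK]
      have : K < max 0 (r - 2) := lt_of_lt_of_le (by linarith) (le_max_right _ _)
      calc 1 * K = K := one_mul K
        _ < max 0 (r - 2) := this
        _ = Real.sqrt ((max 0 (r - 2)) ^ 2) := (Real.sqrt_sq (le_max_left _ _)).symm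
        _ ≤ _ := Real.sqrt_le_sqrt (by nlinarith)
    have h2 : 1 < Real.sqrt (r ^ 2 + ζ ^ 2) / K := by
      rw [lt_div_iff₀ hK]
      calc 1 * K = K := one_mul K
        _ < r := by linarith
        _ = Real.sqrt (r ^ 2) := (Real.sqrt_sq hr0).symm
        _ ≤ _ := Real.sqrt_le_sqrt (by nlinarith)
    rw [profile_eq_zero h1, profile_eq_zero h2]
    simp

/-- **Bump vs minorant at the same point**:
`φ_K(q − y, ζ) − c_K G(√((r + 2)² + ζ²)/K) ≤ (12 c_K/K) · 1_{B̄_∞(y, K)}(q)`. -/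
theorem bump_sub_lateral_minorant_le {K : ℝ} (hK : 0 < K) (ζ : ℝ) (y q : ℝ × ℝ) :
    bump K (![q.1 - y.1, q.2 - y.2, ζ] : Fin 3 → ℝ) - bumpConst / K ^ 3 *
      (max 0 (1 - (max 0 (Real.sqrt ((Real.sqrt ((q.1 - y.1) ^ 2 + (q.2 - y.2) ^ 2) + 2) ^ 2
        + ζ ^ 2) / K)) ^ 2)) ^ 3 ≤
      (closedBall y K).indicator (fun _ => 12 * bumpConst / K ^ 4) q := by
  have hc : 0 ≤ bumpConst / K ^ 3 := div_nonneg bumpConst_pos.le (pow_nonneg hK.le 3)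
  set r : ℝ := Real.sqrt ((q.1 - y.1) ^ 2 + (q.2 - y.2) ^ 2) with hr
  have hr0 : 0 ≤ r := Real.sqrt_nonneg _
  rw [bump_vec_eq_profile hK]
  rw [← hr]
  by_cases hq : q ∈ closedBall y K
  · rw [indicator_of_mem hq, ← mul_sub]
    have hρ : Real.sqrt (r ^ 2 + ζ ^ 2) / K ≤ Real.sqrt ((r + 2) ^ 2 + ζ ^ 2) / K := by
      apply div_le_div_of_nonneg_right _ hK.le
      exact Real.sqrt_le_sqrt (by nlinarith)
    have h := profile_sub_le hρ
    have hd : Real.sqrt ((r + 2) ^ 2 + ζ ^ 2) / K - Real.sqrt (r ^ 2 + ζ ^ 2) / K ≤ 2 / K := by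
      rw [← sub_div]
      apply div_le_div_of_nonneg_right _ hK.le
      have := sqrt_sq_add_sub_le (r + 2) r ζ
      rw [show r + 2 - r = 2 by ring, abs_of_pos (by norm_num : (0 : ℝ) < 2)] at this
      exact this
    calc bumpConst / K ^ 3 * ((max 0 (1 - max 0 (Real.sqrt (r ^ 2 + ζ ^ 2) / K) ^ 2)) ^ 3 -
          (max 0 (1 - max 0 (Real.sqrt ((r + 2) ^ 2 + ζ ^ 2) / K) ^ 2)) ^ 3)
        ≤ bumpConst / K ^ 3 * (6 * (2 / K)) :=
          mul_le_mul_of_nonneg_left (h.trans (by linarith)) hc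
      _ = 12 * bumpConst / K ^ 4 := by field_simp; ring
  · rw [indicator_of_notMem hq]
    have hq' : K < ‖q - y‖ := by rwa [mem_closedBall, dist_eq_norm, not_le] at hq
    have hrK : K < r := by
      rw [Prod.norm_def] at hq'
      rcases lt_max_iff.1 hq' with h | h
      · rw [Real.norm_eq_abs] at h
        calc K < |q.1 - y.1| := h
          _ = Real.sqrt ((q.1 - y.1) ^ 2) := (Real.sqrt_sq_eq_abs _).symm
          _ ≤ r := Real.sqrt_le_sqrt (by nlinarith)
      · rw [Real.norm_eq_abs] at h
        calc K < |q.2 - y.2| := h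
          _ = Real.sqrt ((q.2 - y.2) ^ 2) := (Real.sqrt_sq_eq_abs _).symm
          _ ≤ r := Real.sqrt_le_sqrt (by nlinarith)
    have h1 : 1 < Real.sqrt (r ^ 2 + ζ ^ 2) / K := by
      rw [lt_div_iff₀ hK]
      calc 1 * K = K := one_mul K
        _ < r := hrK
        _ = Real.sqrt (r ^ 2) := (Real.sqrt_sq hr0).symm
        _ ≤ _ := Real.sqrt_le_sqrt (by nlinarith)
    have h2 : 1 < Real.sqrt ((r + 2) ^ 2 + ζ ^ 2) / K := by
      rw [lt_div_iff₀ hK]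
      calc 1 * K = K := one_mul K
        _ < r + 2 := by linarith
        _ = Real.sqrt ((r + 2) ^ 2) := (Real.sqrt_sq (by linarith)).symm
        _ ≤ _ := Real.sqrt_le_sqrt (by nlinarith)
    rw [profile_eq_zero h1, profile_eq_zero h2]
    simp


end Summit.Ventures.Crystal3D.Theorems.PlateauHeight

end
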